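import Summits.Ventures.PercRepro.S2DirectCell
import Summits.Ventures.PercRepro.S2FlatSharp
import Summits.Ventures.PercRepro.S2TailFlats
import Summits.Ventures.PercRepro.S2ThirteenSixSpreadNine
import Summits.Ventures.PercRepro.RankLevelSetPlaneTenPrime
import Summits.Ventures.PercRepro.S2ElevenEightK2NuSix
import Summits.Ventures.PercRepro.S2LPPhi

/-!
# PercRepro — S2: THE KEY CELLS `(11, d)`, `56 ≤ d ≤ 67` — THE ROW `p = 11` WITHOUT SUB-CELLS (p7, gen 20; sub-claim S2)

For each corank `d` here, `RLS M 11 5` on every `e`-free core of rank `11` on `11 + d` points (coloops allowed, no coloop split): the flat-sharp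
lever `topCount_le_flat_sharp` at the universal core bounds `(19, 10)` on the plain caps `cq3 d / avgChain16 d / avgChain5b d`, the tail by flats
at `(19, 10)`, and the KEY inequality `Φ(11, 5)·U + A ≤ Σ_{s=6}^{10} C(n, s)` (`c025_core_five_cell_key`, S2DirectCell; `Φ(11, 5) = 1991 / 168`,
`S2LP.phiK_eleven_five`) — one numeral per cell (ratios `0.960`, `0.905`, `0.855`, `0.807`, `0.763`, `0.722`, `0.684`, `0.648`, `0.614`, `0.583`, `0.553`, `0.526`). The mirror of the row `p = 13` key cells
(S2ThirteenKeyCellsA/B, gen 19) at `p = 11`. Nothing about the window is claimed. Axioms: standard.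
-/

open scoped Matroid

namespace PercRepro

namespace ThmN

open Set

variable {α : Type}

set_option maxRecDepth 8192 in
/-- **The key cell `(11, 56)`**: `RLS M 11 5` on every `e`-free core of rank `11` on `67` points (caps `1596 / 71032 / 3005971`; `#U ≤ 106450415437661193373677 / 4778415591950`,
`#{r ≤ 5} ≤ 479787839993268466991239 / 21502870163775`, `Σ_{s=6}^{10} C(67, s) = 298244189672`; ratio `0.960`). -/
theorem c025_eleven_key_56 (M : Matroid α) [M.Finite]
    (hR : M.eRank = ((11 : ℕ) : ℕ∞)) (hn : M.E.ncard = 11 + 56)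
    (hfree : ∀ e ∈ M.E, ∃ A ⊆ M.E \ {e}, e ∉ M.closure A ∧ e ∉ M.closure ((M.E \ {e}) \ A)) : RLS M 11 5 := by
  classical
  have hd : M.E.encard = M.eRank + ((56 : ℕ) : ℕ∞) := by
    rw [hR, ← M.ground_finite.cast_ncard_eq, hn]
    push_cast
    ring
  have hs3 := TriangleCap.core_ncard_triangles_le_cq3 M hfree hd
  rw [show TriangleCap.cq3 56 = 1596 by decide] at hs3
  have hs4 := ncard_fourCircuits_le_avgChain16 56 M hfree hd
  rw [show avgChain16 56 = 71032 by decide] at hs4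
  have hs5 := S1.ncard_fiveCircuits_le_avgChain5b 56 M hfree hd
  rw [show S1.avgChain5b 56 = 3005971 by decide] at hs5
  have hflat : ∀ X ⊆ M.E, M.eRk X ≤ 5 → X.ncard ≤ 19 := fun X hX hr => ncard_le_nineteen_of_eRk_le_five_of_free M hfree hX hr
  have hflat' : ∀ X ⊆ M.E, M.eRk X ≤ 4 → X.ncard ≤ 10 := fun X hX hr => ncard_le_ten_of_eRk_le_four_of_free M hfree hX hr
  have hU := topCount_le_flat_sharp M 11 56 (by norm_num) (by norm_num) hR hn hfree 19 10 hflat hflat' (by norm_num) (by norm_num)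
    1596 71032 3005971 hs3 hs4 hs5
  have hA := ncard_eRk_le_five_le_flats M 11 56 (by norm_num) hR hn hfree 19 10 hflat hflat' (by norm_num) (by norm_num)
    (by norm_num) (by norm_num) 1596 71032 3005971 hs3 hs4 hs5
  rw [RLS_iff]
  refine c025_core_five_cell_key M 11 56 hn _ hU _ hA (phiK 11 5) (by rw [S2LP.phiK_eleven_five]; norm_num) ?_
  rw [S2LP.phiK_eleven_five]
  norm_num [Finset.sum_range_succ, Finset.sum_Icc_succ_top, Nat.choose]

set_option maxRecDepth 8192 in
/-- **The key cell `(11, 57)`**: `RLS M 11 5` on every `e`-free core of rank `11` on `68` points (caps `1653 / 75930 / 3269652`; `#U ≤ 422322774736223115574817 / 17202296131020`,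
`#{r ≤ 5} ≤ 422979998801636363603513 / 17202296131020`, `Σ_{s=6}^{10} C(68, s) = 348503356344`; ratio `0.905`). -/
theorem c025_eleven_key_57 (M : Matroid α) [M.Finite]
    (hR : M.eRank = ((11 : ℕ) : ℕ∞)) (hn : M.E.ncard = 11 + 57)
    (hfree : ∀ e ∈ M.E, ∃ A ⊆ M.E \ {e}, e ∉ M.closure A ∧ e ∉ M.closure ((M.E \ {e}) \ A)) : RLS M 11 5 := by
  classical
  have hd : M.E.encard = M.eRank + ((57 : ℕ) : ℕ∞) := by
    rw [hR, ← M.ground_finite.cast_ncard_eq, hn]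
    push_cast
    ring
  have hs3 := TriangleCap.core_ncard_triangles_le_cq3 M hfree hd
  rw [show TriangleCap.cq3 57 = 1653 by decide] at hs3
  have hs4 := ncard_fourCircuits_le_avgChain16 57 M hfree hd
  rw [show avgChain16 57 = 75930 by decide] at hs4
  have hs5 := S1.ncard_fiveCircuits_le_avgChain5b 57 M hfree hd
  rw [show S1.avgChain5b 57 = 3269652 by decide] at hs5
  have hflat : ∀ X ⊆ M.E, M.eRk X ≤ 5 → X.ncard ≤ 19 := fun X hX hr => ncard_le_nineteen_of_eRk_le_five_of_free M hfree hX hr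
  have hflat' : ∀ X ⊆ M.E, M.eRk X ≤ 4 → X.ncard ≤ 10 := fun X hX hr => ncard_le_ten_of_eRk_le_four_of_free M hfree hX hr
  have hU := topCount_le_flat_sharp M 11 57 (by norm_num) (by norm_num) hR hn hfree 19 10 hflat hflat' (by norm_num) (by norm_num)
    1653 75930 3269652 hs3 hs4 hs5
  have hA := ncard_eRk_le_five_le_flats M 11 57 (by norm_num) hR hn hfree 19 10 hflat hflat' (by norm_num) (by norm_num)
    (by norm_num) (by norm_num) 1653 75930 3269652 hs3 hs4 hs5
  rw [RLS_iff]
  refine c025_core_five_cell_key M 11 57 hn _ hU _ hA (phiK 11 5) (by rw [S2LP.phiK_eleven_five]; norm_num) ?_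
  rw [S2LP.phiK_eleven_five]
  norm_num [Finset.sum_range_succ, Finset.sum_Icc_succ_top, Nat.choose]

set_option maxRecDepth 8192 in
/-- **The key cell `(11, 58)`**: `RLS M 11 5` on every `e`-free core of rank `11` on `69` points (caps `1711 / 81077 / 3551518`; `#U ≤ 2323462897616255206718707 / 86011480655100`,
`#{r ≤ 5} ≤ 775668795168187993614809 / 28670493551700`, `Σ_{s=6}^{10} C(69, s) = 406264752608`; ratio `0.855`). -/
theorem c025_eleven_key_58 (M : Matroid α) [M.Finite]
    (hR : M.eRank = ((11 : ℕ) : ℕ∞)) (hn : M.E.ncard = 11 + 58)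
    (hfree : ∀ e ∈ M.E, ∃ A ⊆ M.E \ {e}, e ∉ M.closure A ∧ e ∉ M.closure ((M.E \ {e}) \ A)) : RLS M 11 5 := by
  classical
  have hd : M.E.encard = M.eRank + ((58 : ℕ) : ℕ∞) := by
    rw [hR, ← M.ground_finite.cast_ncard_eq, hn]
    push_cast
    ring
  have hs3 := TriangleCap.core_ncard_triangles_le_cq3 M hfree hd
  rw [show TriangleCap.cq3 58 = 1711 by decide] at hs3
  have hs4 := ncard_fourCircuits_le_avgChain16 58 M hfree hd
  rw [show avgChain16 58 = 81077 by decide] at hs4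
  have hs5 := S1.ncard_fiveCircuits_le_avgChain5b 58 M hfree hd
  rw [show S1.avgChain5b 58 = 3551518 by decide] at hs5
  have hflat : ∀ X ⊆ M.E, M.eRk X ≤ 5 → X.ncard ≤ 19 := fun X hX hr => ncard_le_nineteen_of_eRk_le_five_of_free M hfree hX hr
  have hflat' : ∀ X ⊆ M.E, M.eRk X ≤ 4 → X.ncard ≤ 10 := fun X hX hr => ncard_le_ten_of_eRk_le_four_of_free M hfree hX hr
  have hU := topCount_le_flat_sharp M 11 58 (by norm_num) (by norm_num) hR hn hfree 19 10 hflat hflat' (by norm_num) (by norm_num)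
    1711 81077 3551518 hs3 hs4 hs5
  have hA := ncard_eRk_le_five_le_flats M 11 58 (by norm_num) hR hn hfree 19 10 hflat hflat' (by norm_num) (by norm_num)
    (by norm_num) (by norm_num) 1711 81077 3551518 hs3 hs4 hs5
  rw [RLS_iff]
  refine c025_core_five_cell_key M 11 58 hn _ hU _ hA (phiK 11 5) (by rw [S2LP.phiK_eleven_five]; norm_num) ?_
  rw [S2LP.phiK_eleven_five]
  norm_num [Finset.sum_range_succ, Finset.sum_Icc_succ_top, Nat.choose]

set_option maxRecDepth 8192 in
/-- **The key cell `(11, 59)`**: `RLS M 11 5` on every `e`-free core of rank `11` on `70` points (caps `1770 / 86482 / 3852494`; `#U ≤ 1276367936852692646826641 / 43005740327550`,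
`#{r ≤ 5} ≤ 142030698097430129202079 / 4778415591950`, `Σ_{s=6}^{10} C(70, s) = 472508294401`; ratio `0.807`). -/
theorem c025_eleven_key_59 (M : Matroid α) [M.Finite]
    (hR : M.eRank = ((11 : ℕ) : ℕ∞)) (hn : M.E.ncard = 11 + 59)
    (hfree : ∀ e ∈ M.E, ∃ A ⊆ M.E \ {e}, e ∉ M.closure A ∧ e ∉ M.closure ((M.E \ {e}) \ A)) : RLS M 11 5 := by
  classical
  have hd : M.E.encard = M.eRank + ((59 : ℕ) : ℕ∞) := by
    rw [hR, ← M.ground_finite.cast_ncard_eq, hn]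
    push_cast
    ring
  have hs3 := TriangleCap.core_ncard_triangles_le_cq3 M hfree hd
  rw [show TriangleCap.cq3 59 = 1770 by decide] at hs3
  have hs4 := ncard_fourCircuits_le_avgChain16 59 M hfree hd
  rw [show avgChain16 59 = 86482 by decide] at hs4
  have hs5 := S1.ncard_fiveCircuits_le_avgChain5b 59 M hfree hd
  rw [show S1.avgChain5b 59 = 3852494 by decide] at hs5
  have hflat : ∀ X ⊆ M.E, M.eRk X ≤ 5 → X.ncard ≤ 19 := fun X hX hr => ncard_le_nineteen_of_eRk_le_five_of_free M hfree hX hr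
  have hflat' : ∀ X ⊆ M.E, M.eRk X ≤ 4 → X.ncard ≤ 10 := fun X hX hr => ncard_le_ten_of_eRk_le_four_of_free M hfree hX hr
  have hU := topCount_le_flat_sharp M 11 59 (by norm_num) (by norm_num) hR hn hfree 19 10 hflat hflat' (by norm_num) (by norm_num)
    1770 86482 3852494 hs3 hs4 hs5
  have hA := ncard_eRk_le_five_le_flats M 11 59 (by norm_num) hR hn hfree 19 10 hflat hflat' (by norm_num) (by norm_num)
    (by norm_num) (by norm_num) 1770 86482 3852494 hs3 hs4 hs5
  rw [RLS_iff]
  refine c025_core_five_cell_key M 11 59 hn _ hU _ hA (phiK 11 5) (by rw [S2LP.phiK_eleven_five]; norm_num) ?_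
  rw [S2LP.phiK_eleven_five]
  norm_num [Finset.sum_range_succ, Finset.sum_Icc_succ_top, Nat.choose]

set_option maxRecDepth 8192 in
/-- **The key cell `(11, 60)`**: `RLS M 11 5` on every `e`-free core of rank `11` on `71` points (caps `1830 / 92152 / 4173535`; `#U ≤ 466757768781581167020043 / 14335246775850`,
`#{r ≤ 5} ≤ 701163259253748143750267 / 21502870163775`, `Σ_{s=6}^{10} C(71, s) = 548324167600`; ratio `0.763`). -/
theorem c025_eleven_key_60 (M : Matroid α) [M.Finite]
    (hR : M.eRank = ((11 : ℕ) : ℕ∞)) (hn : M.E.ncard = 11 + 60)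
    (hfree : ∀ e ∈ M.E, ∃ A ⊆ M.E \ {e}, e ∉ M.closure A ∧ e ∉ M.closure ((M.E \ {e}) \ A)) : RLS M 11 5 := by
  classical
  have hd : M.E.encard = M.eRank + ((60 : ℕ) : ℕ∞) := by
    rw [hR, ← M.ground_finite.cast_ncard_eq, hn]
    push_cast
    ring
  have hs3 := TriangleCap.core_ncard_triangles_le_cq3 M hfree hd
  rw [show TriangleCap.cq3 60 = 1830 by decide] at hs3
  have hs4 := ncard_fourCircuits_le_avgChain16 60 M hfree hd
  rw [show avgChain16 60 = 92152 by decide] at hs4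
  have hs5 := S1.ncard_fiveCircuits_le_avgChain5b 60 M hfree hd
  rw [show S1.avgChain5b 60 = 4173535 by decide] at hs5
  have hflat : ∀ X ⊆ M.E, M.eRk X ≤ 5 → X.ncard ≤ 19 := fun X hX hr => ncard_le_nineteen_of_eRk_le_five_of_free M hfree hX hr
  have hflat' : ∀ X ⊆ M.E, M.eRk X ≤ 4 → X.ncard ≤ 10 := fun X hX hr => ncard_le_ten_of_eRk_le_four_of_free M hfree hX hr
  have hU := topCount_le_flat_sharp M 11 60 (by norm_num) (by norm_num) hR hn hfree 19 10 hflat hflat' (by norm_num) (by norm_num)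
    1830 92152 4173535 hs3 hs4 hs5
  have hA := ncard_eRk_le_five_le_flats M 11 60 (by norm_num) hR hn hfree 19 10 hflat hflat' (by norm_num) (by norm_num)
    (by norm_num) (by norm_num) 1830 92152 4173535 hs3 hs4 hs5
  rw [RLS_iff]
  refine c025_core_five_cell_key M 11 60 hn _ hU _ hA (phiK 11 5) (by rw [S2LP.phiK_eleven_five]; norm_num) ?_
  rw [S2LP.phiK_eleven_five]
  norm_num [Finset.sum_range_succ, Finset.sum_Icc_succ_top, Nat.choose]

set_option maxRecDepth 8192 in
/-- **The key cell `(11, 61)`**: `RLS M 11 5` on every `e`-free core of rank `11` on `72` points (caps `1891 / 98097 / 4515628`; `#U ≤ 11116265372702052603961 / 311635799475`,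
`#{r ≤ 5} ≤ 33396768364564108752008 / 934907398425`, `Σ_{s=6}^{10} C(72, s) = 634923302333`; ratio `0.722`). -/
theorem c025_eleven_key_61 (M : Matroid α) [M.Finite]
    (hR : M.eRank = ((11 : ℕ) : ℕ∞)) (hn : M.E.ncard = 11 + 61)
    (hfree : ∀ e ∈ M.E, ∃ A ⊆ M.E \ {e}, e ∉ M.closure A ∧ e ∉ M.closure ((M.E \ {e}) \ A)) : RLS M 11 5 := by
  classical
  have hd : M.E.encard = M.eRank + ((61 : ℕ) : ℕ∞) := by
    rw [hR, ← M.ground_finite.cast_ncard_eq, hn]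
    push_cast
    ring
  have hs3 := TriangleCap.core_ncard_triangles_le_cq3 M hfree hd
  rw [show TriangleCap.cq3 61 = 1891 by decide] at hs3
  have hs4 := ncard_fourCircuits_le_avgChain16 61 M hfree hd
  rw [show avgChain16 61 = 98097 by decide] at hs4
  have hs5 := S1.ncard_fiveCircuits_le_avgChain5b 61 M hfree hd
  rw [show S1.avgChain5b 61 = 4515628 by decide] at hs5
  have hflat : ∀ X ⊆ M.E, M.eRk X ≤ 5 → X.ncard ≤ 19 := fun X hX hr => ncard_le_nineteen_of_eRk_le_five_of_free M hfree hX hr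
  have hflat' : ∀ X ⊆ M.E, M.eRk X ≤ 4 → X.ncard ≤ 10 := fun X hX hr => ncard_le_ten_of_eRk_le_four_of_free M hfree hX hr
  have hU := topCount_le_flat_sharp M 11 61 (by norm_num) (by norm_num) hR hn hfree 19 10 hflat hflat' (by norm_num) (by norm_num)
    1891 98097 4515628 hs3 hs4 hs5
  have hA := ncard_eRk_le_five_le_flats M 11 61 (by norm_num) hR hn hfree 19 10 hflat hflat' (by norm_num) (by norm_num)
    (by norm_num) (by norm_num) 1891 98097 4515628 hs3 hs4 hs5
  rw [RLS_iff]
  refine c025_core_five_cell_key M 11 61 hn _ hU _ hA (phiK 11 5) (by rw [S2LP.phiK_eleven_five]; norm_num) ?_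
  rw [S2LP.phiK_eleven_five]
  norm_num [Finset.sum_range_succ, Finset.sum_Icc_succ_top, Nat.choose]

set_option maxRecDepth 8192 in
/-- **The key cell `(11, 62)`**: `RLS M 11 5` on every `e`-free core of rank `11` on `73` points (caps `1953 / 104325 / 4879791`; `#U ≤ 559432221848610184765891 / 14335246775850`,
`#{r ≤ 5} ≤ 280110986387392551919628 / 7167623387925`, `Σ_{s=6}^{10} C(73, s) = 733648663954`; ratio `0.684`). -/
theorem c025_eleven_key_62 (M : Matroid α) [M.Finite]
    (hR : M.eRank = ((11 : ℕ) : ℕ∞)) (hn : M.E.ncard = 11 + 62)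
    (hfree : ∀ e ∈ M.E, ∃ A ⊆ M.E \ {e}, e ∉ M.closure A ∧ e ∉ M.closure ((M.E \ {e}) \ A)) : RLS M 11 5 := by
  classical
  have hd : M.E.encard = M.eRank + ((62 : ℕ) : ℕ∞) := by
    rw [hR, ← M.ground_finite.cast_ncard_eq, hn]
    push_cast
    ring
  have hs3 := TriangleCap.core_ncard_triangles_le_cq3 M hfree hd
  rw [show TriangleCap.cq3 62 = 1953 by decide] at hs3
  have hs4 := ncard_fourCircuits_le_avgChain16 62 M hfree hd
  rw [show avgChain16 62 = 104325 by decide] at hs4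
  have hs5 := S1.ncard_fiveCircuits_le_avgChain5b 62 M hfree hd
  rw [show S1.avgChain5b 62 = 4879791 by decide] at hs5
  have hflat : ∀ X ⊆ M.E, M.eRk X ≤ 5 → X.ncard ≤ 19 := fun X hX hr => ncard_le_nineteen_of_eRk_le_five_of_free M hfree hX hr
  have hflat' : ∀ X ⊆ M.E, M.eRk X ≤ 4 → X.ncard ≤ 10 := fun X hX hr => ncard_le_ten_of_eRk_le_four_of_free M hfree hX hr
  have hU := topCount_le_flat_sharp M 11 62 (by norm_num) (by norm_num) hR hn hfree 19 10 hflat hflat' (by norm_num) (by norm_num)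
    1953 104325 4879791 hs3 hs4 hs5
  have hA := ncard_eRk_le_five_le_flats M 11 62 (by norm_num) hR hn hfree 19 10 hflat hflat' (by norm_num) (by norm_num)
    (by norm_num) (by norm_num) 1953 104325 4879791 hs3 hs4 hs5
  rw [RLS_iff]
  refine c025_core_five_cell_key M 11 62 hn _ hU _ hA (phiK 11 5) (by rw [S2LP.phiK_eleven_five]; norm_num) ?_
  rw [S2LP.phiK_eleven_five]
  norm_num [Finset.sum_range_succ, Finset.sum_Icc_succ_top, Nat.choose]

set_option maxRecDepth 8192 in
/-- **The key cell `(11, 63)`**: `RLS M 11 5` on every `e`-free core of rank `11` on `74` points (caps `2016 / 110845 / 5267076`; `#U ≤ 407483806262424688299473 / 9556831183900`,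
`#{r ≤ 5} ≤ 3672436641006161768706697 / 86011480655100`, `Σ_{s=6}^{10} C(74, s) = 845987410866`; ratio `0.648`). -/
theorem c025_eleven_key_63 (M : Matroid α) [M.Finite]
    (hR : M.eRank = ((11 : ℕ) : ℕ∞)) (hn : M.E.ncard = 11 + 63)
    (hfree : ∀ e ∈ M.E, ∃ A ⊆ M.E \ {e}, e ∉ M.closure A ∧ e ∉ M.closure ((M.E \ {e}) \ A)) : RLS M 11 5 := by
  classical
  have hd : M.E.encard = M.eRank + ((63 : ℕ) : ℕ∞) := by
    rw [hR, ← M.ground_finite.cast_ncard_eq, hn]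
    push_cast
    ring
  have hs3 := TriangleCap.core_ncard_triangles_le_cq3 M hfree hd
  rw [show TriangleCap.cq3 63 = 2016 by decide] at hs3
  have hs4 := ncard_fourCircuits_le_avgChain16 63 M hfree hd
  rw [show avgChain16 63 = 110845 by decide] at hs4
  have hs5 := S1.ncard_fiveCircuits_le_avgChain5b 63 M hfree hd
  rw [show S1.avgChain5b 63 = 5267076 by decide] at hs5
  have hflat : ∀ X ⊆ M.E, M.eRk X ≤ 5 → X.ncard ≤ 19 := fun X hX hr => ncard_le_nineteen_of_eRk_le_five_of_free M hfree hX hr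
  have hflat' : ∀ X ⊆ M.E, M.eRk X ≤ 4 → X.ncard ≤ 10 := fun X hX hr => ncard_le_ten_of_eRk_le_four_of_free M hfree hX hr
  have hU := topCount_le_flat_sharp M 11 63 (by norm_num) (by norm_num) hR hn hfree 19 10 hflat hflat' (by norm_num) (by norm_num)
    2016 110845 5267076 hs3 hs4 hs5
  have hA := ncard_eRk_le_five_le_flats M 11 63 (by norm_num) hR hn hfree 19 10 hflat hflat' (by norm_num) (by norm_num)
    (by norm_num) (by norm_num) 2016 110845 5267076 hs3 hs4 hs5
  rw [RLS_iff]
  refine c025_core_five_cell_key M 11 63 hn _ hU _ hA (phiK 11 5) (by rw [S2LP.phiK_eleven_five]; norm_num) ?_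
  rw [S2LP.phiK_eleven_five]
  norm_num [Finset.sum_range_succ, Finset.sum_Icc_succ_top, Nat.choose]

set_option maxRecDepth 8192 in
/-- **The key cell `(11, 64)`**: `RLS M 11 5` on every `e`-free core of rank `11` on `75` points (caps `2080 / 117666 / 5678566`; `#U ≤ 181896570543172879101959 / 3909612757050`,
`#{r ≤ 5} ≤ 60714703618950617318833 / 1303204252350`, `Σ_{s=6}^{10} C(75, s) = 973583971655`; ratio `0.614`). -/
theorem c025_eleven_key_64 (M : Matroid α) [M.Finite]
    (hR : M.eRank = ((11 : ℕ) : ℕ∞)) (hn : M.E.ncard = 11 + 64)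
    (hfree : ∀ e ∈ M.E, ∃ A ⊆ M.E \ {e}, e ∉ M.closure A ∧ e ∉ M.closure ((M.E \ {e}) \ A)) : RLS M 11 5 := by
  classical
  have hd : M.E.encard = M.eRank + ((64 : ℕ) : ℕ∞) := by
    rw [hR, ← M.ground_finite.cast_ncard_eq, hn]
    push_cast
    ring
  have hs3 := TriangleCap.core_ncard_triangles_le_cq3 M hfree hd
  rw [show TriangleCap.cq3 64 = 2080 by decide] at hs3
  have hs4 := ncard_fourCircuits_le_avgChain16 64 M hfree hd
  rw [show avgChain16 64 = 117666 by decide] at hs4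
  have hs5 := S1.ncard_fiveCircuits_le_avgChain5b 64 M hfree hd
  rw [show S1.avgChain5b 64 = 5678566 by decide] at hs5
  have hflat : ∀ X ⊆ M.E, M.eRk X ≤ 5 → X.ncard ≤ 19 := fun X hX hr => ncard_le_nineteen_of_eRk_le_five_of_free M hfree hX hr
  have hflat' : ∀ X ⊆ M.E, M.eRk X ≤ 4 → X.ncard ≤ 10 := fun X hX hr => ncard_le_ten_of_eRk_le_four_of_free M hfree hX hr
  have hU := topCount_le_flat_sharp M 11 64 (by norm_num) (by norm_num) hR hn hfree 19 10 hflat hflat' (by norm_num) (by norm_num)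
    2080 117666 5678566 hs3 hs4 hs5
  have hA := ncard_eRk_le_five_le_flats M 11 64 (by norm_num) hR hn hfree 19 10 hflat hflat' (by norm_num) (by norm_num)
    (by norm_num) (by norm_num) 2080 117666 5678566 hs3 hs4 hs5
  rw [RLS_iff]
  refine c025_core_five_cell_key M 11 64 hn _ hU _ hA (phiK 11 5) (by rw [S2LP.phiK_eleven_five]; norm_num) ?_
  rw [S2LP.phiK_eleven_five]
  norm_num [Finset.sum_range_succ, Finset.sum_Icc_succ_top, Nat.choose]

set_option maxRecDepth 8192 in
/-- **The key cell `(11, 65)`**: `RLS M 11 5` on every `e`-free core of rank `11` on `76` points (caps `2145 / 124797 / 6115378`; `#U ≤ 107881662062112119465 / 2127680412`,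
`#{r ≤ 5} ≤ 1620388135148911834819 / 31915206180`, `Σ_{s=6}^{10} C(76, s) = 1118254096345`; ratio `0.583`). -/
theorem c025_eleven_key_65 (M : Matroid α) [M.Finite]
    (hR : M.eRank = ((11 : ℕ) : ℕ∞)) (hn : M.E.ncard = 11 + 65)
    (hfree : ∀ e ∈ M.E, ∃ A ⊆ M.E \ {e}, e ∉ M.closure A ∧ e ∉ M.closure ((M.E \ {e}) \ A)) : RLS M 11 5 := by
  classical
  have hd : M.E.encard = M.eRank + ((65 : ℕ) : ℕ∞) := by
    rw [hR, ← M.ground_finite.cast_ncard_eq, hn]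
    push_cast
    ring
  have hs3 := TriangleCap.core_ncard_triangles_le_cq3 M hfree hd
  rw [show TriangleCap.cq3 65 = 2145 by decide] at hs3
  have hs4 := ncard_fourCircuits_le_avgChain16 65 M hfree hd
  rw [show avgChain16 65 = 124797 by decide] at hs4
  have hs5 := S1.ncard_fiveCircuits_le_avgChain5b 65 M hfree hd
  rw [show S1.avgChain5b 65 = 6115378 by decide] at hs5
  have hflat : ∀ X ⊆ M.E, M.eRk X ≤ 5 → X.ncard ≤ 19 := fun X hX hr => ncard_le_nineteen_of_eRk_le_five_of_free M hfree hX hr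
  have hflat' : ∀ X ⊆ M.E, M.eRk X ≤ 4 → X.ncard ≤ 10 := fun X hX hr => ncard_le_ten_of_eRk_le_four_of_free M hfree hX hr
  have hU := topCount_le_flat_sharp M 11 65 (by norm_num) (by norm_num) hR hn hfree 19 10 hflat hflat' (by norm_num) (by norm_num)
    2145 124797 6115378 hs3 hs4 hs5
  have hA := ncard_eRk_le_five_le_flats M 11 65 (by norm_num) hR hn hfree 19 10 hflat hflat' (by norm_num) (by norm_num)
    (by norm_num) (by norm_num) 2145 124797 6115378 hs3 hs4 hs5
  rw [RLS_iff]
  refine c025_core_five_cell_key M 11 65 hn _ hU _ hA (phiK 11 5) (by rw [S2LP.phiK_eleven_five]; norm_num) ?_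
  rw [S2LP.phiK_eleven_five]
  norm_num [Finset.sum_range_succ, Finset.sum_Icc_succ_top, Nat.choose]

set_option maxRecDepth 8192 in
/-- **The key cell `(11, 66)`**: `RLS M 11 5` on every `e`-free core of rank `11` on `77` points (caps `2211 / 132247 / 6578664`; `#U ≤ 678143189112300121493359 / 12287354379300`,
`#{r ≤ 5} ≤ 679033913885111634252479 / 12287354379300`, `Σ_{s=6}^{10} C(77, s) = 1281999939000`; ratio `0.553`). -/
theorem c025_eleven_key_66 (M : Matroid α) [M.Finite]
    (hR : M.eRank = ((11 : ℕ) : ℕ∞)) (hn : M.E.ncard = 11 + 66)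
    (hfree : ∀ e ∈ M.E, ∃ A ⊆ M.E \ {e}, e ∉ M.closure A ∧ e ∉ M.closure ((M.E \ {e}) \ A)) : RLS M 11 5 := by
  classical
  have hd : M.E.encard = M.eRank + ((66 : ℕ) : ℕ∞) := by
    rw [hR, ← M.ground_finite.cast_ncard_eq, hn]
    push_cast
    ring
  have hs3 := TriangleCap.core_ncard_triangles_le_cq3 M hfree hd
  rw [show TriangleCap.cq3 66 = 2211 by decide] at hs3
  have hs4 := ncard_fourCircuits_le_avgChain16 66 M hfree hd
  rw [show avgChain16 66 = 132247 by decide] at hs4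
  have hs5 := S1.ncard_fiveCircuits_le_avgChain5b 66 M hfree hd
  rw [show S1.avgChain5b 66 = 6578664 by decide] at hs5
  have hflat : ∀ X ⊆ M.E, M.eRk X ≤ 5 → X.ncard ≤ 19 := fun X hX hr => ncard_le_nineteen_of_eRk_le_five_of_free M hfree hX hr
  have hflat' : ∀ X ⊆ M.E, M.eRk X ≤ 4 → X.ncard ≤ 10 := fun X hX hr => ncard_le_ten_of_eRk_le_four_of_free M hfree hX hr
  have hU := topCount_le_flat_sharp M 11 66 (by norm_num) (by norm_num) hR hn hfree 19 10 hflat hflat' (by norm_num) (by norm_num)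
    2211 132247 6578664 hs3 hs4 hs5
  have hA := ncard_eRk_le_five_le_flats M 11 66 (by norm_num) hR hn hfree 19 10 hflat hflat' (by norm_num) (by norm_num)
    (by norm_num) (by norm_num) 2211 132247 6578664 hs3 hs4 hs5
  rw [RLS_iff]
  refine c025_core_five_cell_key M 11 66 hn _ hU _ hA (phiK 11 5) (by rw [S2LP.phiK_eleven_five]; norm_num) ?_
  rw [S2LP.phiK_eleven_five]
  norm_num [Finset.sum_range_succ, Finset.sum_Icc_succ_top, Nat.choose]

set_option maxRecDepth 8192 in
/-- **The key cell `(11, 67)`**: `RLS M 11 5` on every `e`-free core of rank `11` on `78` points (caps `2278 / 140026 / 7069609`; `#U ≤ 81919519204889995534793 / 1365261597700`,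
`#{r ≤ 5} ≤ 246075818730383735481049 / 4095784793100`, `Σ_{s=6}^{10} C(78, s) = 1467026231385`; ratio `0.526`). -/
theorem c025_eleven_key_67 (M : Matroid α) [M.Finite]
    (hR : M.eRank = ((11 : ℕ) : ℕ∞)) (hn : M.E.ncard = 11 + 67)
    (hfree : ∀ e ∈ M.E, ∃ A ⊆ M.E \ {e}, e ∉ M.closure A ∧ e ∉ M.closure ((M.E \ {e}) \ A)) : RLS M 11 5 := by
  classical
  have hd : M.E.encard = M.eRank + ((67 : ℕ) : ℕ∞) := by
    rw [hR, ← M.ground_finite.cast_ncard_eq, hn]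
    push_cast
    ring
  have hs3 := TriangleCap.core_ncard_triangles_le_cq3 M hfree hd
  rw [show TriangleCap.cq3 67 = 2278 by decide] at hs3
  have hs4 := ncard_fourCircuits_le_avgChain16 67 M hfree hd
  rw [show avgChain16 67 = 140026 by decide] at hs4
  have hs5 := S1.ncard_fiveCircuits_le_avgChain5b 67 M hfree hd
  rw [show S1.avgChain5b 67 = 7069609 by decide] at hs5
  have hflat : ∀ X ⊆ M.E, M.eRk X ≤ 5 → X.ncard ≤ 19 := fun X hX hr => ncard_le_nineteen_of_eRk_le_five_of_free M hfree hX hr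
  have hflat' : ∀ X ⊆ M.E, M.eRk X ≤ 4 → X.ncard ≤ 10 := fun X hX hr => ncard_le_ten_of_eRk_le_four_of_free M hfree hX hr
  have hU := topCount_le_flat_sharp M 11 67 (by norm_num) (by norm_num) hR hn hfree 19 10 hflat hflat' (by norm_num) (by norm_num)
    2278 140026 7069609 hs3 hs4 hs5
  have hA := ncard_eRk_le_five_le_flats M 11 67 (by norm_num) hR hn hfree 19 10 hflat hflat' (by norm_num) (by norm_num)
    (by norm_num) (by norm_num) 2278 140026 7069609 hs3 hs4 hs5
  rw [RLS_iff]
  refine c025_core_five_cell_key M 11 67 hn _ hU _ hA (phiK 11 5) (by rw [S2LP.phiK_eleven_five]; norm_num) ?_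
  rw [S2LP.phiK_eleven_five]
  norm_num [Finset.sum_range_succ, Finset.sum_Icc_succ_top, Nat.choose]


end ThmN

end PercRepro
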